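import Summits.NavierStokesRegularity.NavierStokesRegularity.Theorems.FilamentSkeletonRssKelvinGateTools

/-!
# Route `FilamentSkeletonRss` · crux `TransverseReductionRJ` (stmt-NavierStokesRegularity-21221) — line `kelvin_gate`,
# stubs S2 → S3 INTERFACE: a gate output at the fixed-point forcing solves the crux's profile equation exactly

Helper file (theorems only, `--supports stmt-NavierStokesRegularity-21221 --as helper`), in the vocabulary of
`FilamentSkeletonRssKelvinGateDefs`.  HONEST FRAMING: bookkeeping for a HYPOTHETICAL filament-type RSS blow-up route;
nothing here bears on Navier–Stokes regularity; no stub is proved here.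

This file certifies that the equation clause of the gate spec (stub S2, `GateSpec`) is EXACTLY what the nonlinear
closing (stub S3) consumes — an interface check between the two registered stubs:

* `gradient_fun_add'` — `∇(P⁰ + Q) = ∇P⁰ + ∇Q` at differentiable points (componentwise `fderiv`);
* `profileEquation_of_linearised` — pure algebra: if `(W, Q, b)` solves the linearised system
  `𝓛_(α,U⁰) W + ∇Q = −r − DW[W] + Σ_j b_j D_j` at `y`, where `r = E_α(U⁰) + ∇P⁰ − Σ_j b⁰_j D_j` is the base
  residual, then `U = U⁰ + W`, `P = P⁰ + Q`, `B = b⁰ + b` solve the crux's profile equation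
  `E_α(U) + ∇P = Σ_j B_j D_j` at `y` (by `lerayOp_add_eq`: `E(U⁰+W) = E(U⁰) + 𝓛W + DW[W]`);
* `GateSpec.profileEquation_of_fixedPoint` — the packaged form: for a base family `(U⁰, P⁰, b⁰)` (only `C²`/`C¹`
  regularity is used), a gate `(𝓚, 𝓠, 𝓑)` satisfying `GateSpec` at `p`, and ANY Y-bounded forcing `F` satisfying the
  fixed-point relation `F = −r_p − D(𝓚_p F)[𝓚_p F]`, the family `U_p = U⁰_p + 𝓚_p F`, `P_p = P⁰_p + 𝓠_p F`,
  `B_p = b⁰_p + 𝓑_p F` satisfies the profile equation of `AlmostAdmissibleJ` VERBATIM at every point.  (Existence of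
  such an `F`, its size, decay, window-closeness and continuity in `p` are stub S3's burden; this file is the algebra.)
-/

set_option linter.dupNamespace false

noncomputable section

namespace Summit.NavierStokesRegularity.NavierStokesRegularity.Theorems.KelvinGate

open Set Function
open Literature.Analysis.FluidPDE
open scoped InnerProductSpace Laplacian ContDiff Topology

/-- `∇(P + Q)(y) = ∇P(y) + ∇Q(y)` at points where both scalars are differentiable. -/
theorem gradient_fun_add' {P Q : EuclideanSpace ℝ (Fin 3) → ℝ} {y : EuclideanSpace ℝ (Fin 3)}
    (hP : DifferentiableAt ℝ P y) (hQ : DifferentiableAt ℝ Q y) :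
    gradient (fun z => P z + Q z) y = gradient P y + gradient Q y := by
  simp only [gradient, fderiv_fun_add hP hQ, map_add]

/-- **Linearised solve at the fixed-point forcing ⇒ exact profile equation (pointwise algebra).**  With
`r = E_α(U⁰)(y) + ∇P⁰(y) − Σ_j b⁰_j D_j(y)` the base residual at `y`: if
`𝓛_(α,U⁰) W (y) + ∇Q(y) = (−r − DW(y)[W(y)]) + Σ_j b_j D_j(y)` then
`E_α(U⁰ + W)(y) + ∇(P⁰ + Q)(y) = Σ_j (b⁰_j + b_j) D_j(y)`. -/
theorem profileEquation_of_linearised (α : ℝ) {N : ℕ} {U0 W : EuclideanSpace ℝ (Fin 3) → EuclideanSpace ℝ (Fin 3)}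
    {P0 Q : EuclideanSpace ℝ (Fin 3) → ℝ} {Dm : Fin N → EuclideanSpace ℝ (Fin 3) → EuclideanSpace ℝ (Fin 3)}
    {b0 b : Fin N → ℝ} {y : EuclideanSpace ℝ (Fin 3)}
    (hU : ContDiffAt ℝ 2 U0 y) (hW : ContDiffAt ℝ 2 W y) (hP : DifferentiableAt ℝ P0 y) (hQ : DifferentiableAt ℝ Q y)
    (hsolve : lerayLin α U0 W y + gradient Q y =
      (-(lerayOp α U0 y + gradient P0 y - ∑ j, b0 j • Dm j y) - fderiv ℝ W y (W y)) + ∑ j, b j • Dm j y) :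
    lerayOp α (fun z => U0 z + W z) y + gradient (fun z => P0 z + Q z) y = ∑ j, (b0 j + b j) • Dm j y := by
  rw [lerayOp_add_eq α U0 W y hU hW, gradient_fun_add' hP hQ]
  have e : lerayOp α U0 y + lerayLin α U0 W y + fderiv ℝ W y (W y) + (gradient P0 y + gradient Q y) =
      (lerayOp α U0 y + gradient P0 y + fderiv ℝ W y (W y)) + (lerayLin α U0 W y + gradient Q y) := by abel
  rw [e, hsolve]
  simp only [add_smul, Finset.sum_add_distrib]
  abel

/-- **Stub S2 → stub S3 interface.**  Let `(U⁰, P⁰, b⁰)` be a base family with `U⁰_p ∈ C²`, `P⁰_p ∈ C¹`, let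
`(𝓚, 𝓠, 𝓑)` satisfy `GateSpec` (any constants) and let `p` lie in the cube.  If a Y-bounded forcing `F` satisfies the
FIXED-POINT RELATION of stub S3, `F(y) = −r_p(y) − D(𝓚_p F)(y)[𝓚_p F(y)]` for all `y` (`r_p = baseRes α D U⁰ P⁰ b⁰ p`),
then `U_p := U⁰_p + 𝓚_p F`, `P_p := P⁰_p + 𝓠_p F`, `B_p := b⁰_p + 𝓑_p F` satisfy the crux's profile equation
`α_p(e₃ × U_p − DU_p[e₃ × y]) + ½U_p + ½DU_p[y] − ΔU_p + DU_p[U_p] + ∇P_p = Σ_j B_pj D_pj` at every `y`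
(the equation clause of `AlmostAdmissibleJ`, verbatim). -/
theorem GateSpec.profileEquation_of_fixedPoint {N : ℕ} {Γ κ C₂ : ℝ} {α : (Fin N → ℝ) → ℝ}
    {D : (Fin N → ℝ) → Fin N → EuclideanSpace ℝ (Fin 3) → EuclideanSpace ℝ (Fin 3)}
    {U0 : (Fin N → ℝ) → EuclideanSpace ℝ (Fin 3) → EuclideanSpace ℝ (Fin 3)} {P0 : (Fin N → ℝ) → EuclideanSpace ℝ (Fin 3) → ℝ}
    {b0 : (Fin N → ℝ) → Fin N → ℝ}
    {𝓚 : (Fin N → ℝ) → (EuclideanSpace ℝ (Fin 3) → EuclideanSpace ℝ (Fin 3)) → EuclideanSpace ℝ (Fin 3) → EuclideanSpace ℝ (Fin 3)}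
    {𝓠 : (Fin N → ℝ) → (EuclideanSpace ℝ (Fin 3) → EuclideanSpace ℝ (Fin 3)) → EuclideanSpace ℝ (Fin 3) → ℝ}
    {𝓑 : (Fin N → ℝ) → (EuclideanSpace ℝ (Fin 3) → EuclideanSpace ℝ (Fin 3)) → Fin N → ℝ}
    (hgate : GateSpec N Γ κ C₂ α D U0 𝓚 𝓠 𝓑) {p : Fin N → ℝ} (hp : ∀ i, p i ∈ Icc (0:ℝ) 1)
    (hU : ContDiff ℝ 2 (U0 p)) (hP : Differentiable ℝ (P0 p))
    {F : EuclideanSpace ℝ (Fin 3) → EuclideanSpace ℝ (Fin 3)} {R : ℝ} (hF : YBound F R)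
    (hfix : ∀ y, F y = -(baseRes α D U0 P0 b0 p y) - fderiv ℝ (𝓚 p F) y (𝓚 p F y)) :
    ∀ y, α p • (cross (EuclideanSpace.single 2 1) ((fun z => U0 p z + 𝓚 p F z) y) -
          fderiv ℝ (fun z => U0 p z + 𝓚 p F z) y (cross (EuclideanSpace.single 2 1) y)) +
        (1/2:ℝ) • (fun z => U0 p z + 𝓚 p F z) y + (1/2:ℝ) • fderiv ℝ (fun z => U0 p z + 𝓚 p F z) y y -
        (Laplacian.laplacian (fun z => U0 p z + 𝓚 p F z)) y +
        fderiv ℝ (fun z => U0 p z + 𝓚 p F z) y ((fun z => U0 p z + 𝓚 p F z) y) +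
        gradient (fun z => P0 p z + 𝓠 p F z) y = ∑ j, (b0 p j + 𝓑 p F j) • D p j y := by
  intro y
  obtain ⟨hX, hQ1, -, -, -, heq⟩ := (hgate p hp).1 F R hF
  have hsolve : lerayLin (α p) (U0 p) (𝓚 p F) y + gradient (𝓠 p F) y =
      (-(lerayOp (α p) (U0 p) y + gradient (P0 p) y - ∑ j, b0 p j • D p j y) -
        fderiv ℝ (𝓚 p F) y (𝓚 p F y)) + ∑ j, 𝓑 p F j • D p j y := by
    rw [heq y, hfix y]
    rfl
  exact profileEquation_of_linearised (α p) hU.contDiffAt hX.1.contDiffAt (hP y)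
    (hQ1.differentiable (by norm_num) y) hsolve

end Summit.NavierStokesRegularity.NavierStokesRegularity.Theorems.KelvinGate
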